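import Literature.MathematicalPhysics.QuantumFieldTheory.Balaban1983to89.B1Eq324BenfattoClassSectEMember
import HarnessLib

/-!
# `Balaban1983to89.B1Eq324BenfattoClassSandwichedCutoff` — [Balaban1982Higgs1] (3.24) on a torus block for EVERY small-field cut-off event
# SANDWICHED between two coordinate boxes of comparable thresholds, in particular for print's product of `𝔤`-norm BALLS
# `χ = Π_b χ({|A(b)| < p})` of [Balaban1985UV3] (51)∕(58) — by a monotone sandwich over the class road (seat dag-n08-b gen 15, CLAIM-3; located
# design point «N08 CHECK D (cut-off shape)»)

statement-level companion of a published source with citation tags; every declaration here is a theorem; nothing here is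
a claim about the Yang–Mills mass gap

THE PRINTED LOCUS.  [Balaban1985UV3] (= [B10]) p. 268, (51): *"where χ = Π_{b∈B(Λ_{k+1})} χ({|A(b)| < g_kp²(g_k)})"*; p. 270, (58):
*"∫dμ_{C^{(k)}}(A)χ exp[𝒱(A) + O((L^kε)^{3+κ₀})|T₁^{(k)}|]; cumulant expansion to 6th order"*, with `A(b)` Lie-algebra valued and, as in the
whole series, *"a norm |X| of a N × N matrix means the Hilbert–Schmidt norm"* ([Balaban1985BackgroundPropagators] p. 390) — so `χ` is a PRODUCT OF
EUCLIDEAN BALLS in `𝔤 ≅ ℝ^{d(𝔤)}`, one per bond; [Balaban1982Higgs1] (3.24) p. 616 is likewise stated for an `N`-component field.  The class road of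
this cell ([BenfattoEtAl1978]'s Lemma in class form) carries the cut-off `Π_y 1{|z_y| ≤ p·(1 + d(I,y))}` — one INTERVAL per real coordinate
(`B1Eq324BenfattoLemma.smallFieldSet`, `cutoffBoltzmann`), i.e. a coordinate BOX; for `d(𝔤) ≥ 2` a product of balls is a box in no coordinates.

WHY THIS MODULE (cell `pub-ymgap`, seat `dag-n08-b` gen 15, CLAIM-3; node N08 [Balaban1985UV3]).  Seat n08-w4's located CHECK A
(`N08-CLASS-SOCKET-PRESENTATION-g5.md` §2) showed that the (α)-socket's presentation row `Φ⁻¹'(box) =ᵐ smallFieldSet I p` forces a coordinate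
embedding; the SHAPE point above (CHECK D) says that with print's ball cut-off that row is unsatisfiable as an a.e. IDENTITY.  The remedy needs no
ball edition of the Basic Lemma: `cube(p∕λ) ⊆ balls(p) ⊆ cube(p)` (`λ = √d(𝔤)`), the road's (3.24) holds for EVERY threshold constant `b₀ > b₁`
(`…ClassSectEMember.eq324_torus_of_expDecay_on_unit` over `…KernelEq324AnyGammaUnitRange.eq324_kernel_of_expDecay_on_unit`), its cumulant term does not
see the cut-off, and `p_{b₀∕λ}(η) = p_{b₀}(η)∕λ` (`B10.pFun` is linear in `b₀`); a MONOTONE SANDWICH of the two cut-off integrals then gives the (3.24)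
pair for any measurable event a.e.-between the two boxes, at the price of the window `b₀ > max(0, b₁, λb₁)` and the constant `max(C(b₀), C(b₀∕λ))`.

WHAT IS PROVED (standard axioms; no `sorry`; no definition).
* §1 ★★ `eq324_pair_of_sandwich` — ANY measure, ANY measurable `H`, events `E₁ ⊆ E ⊆ E₂` (`E` measurable): `0 < ∫1_{E_i}e^H` and
  `|log ∫1_{E_i}e^H − c| ≤ ε` (i = 1, 2) ⇒ `0 < ∫1_E e^H ∧ |log ∫1_E e^H − c| ≤ ε`.
* §2 `abs_le_of_ballProduct`, `ballProduct_of_abs_le` — for variables `β` fibred over bonds `π : β → B` with fibres of size `≤ n`: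
  `√(Σ_{π b = b₀} ω_b²) ≤ p ⇒ |ω_b| ≤ p` and `(∀ b, |ω_b| ≤ p∕√n) ⇒ √(Σ_{π b = b₀} ω_b²) ≤ p` (`p ≥ 0`); `measurableSet_ballProduct`.
* §3 ★★★ `eq324_torus_sandwichedCutoff_on_unit` — seat n08-b's `eq324_torus_of_expDecay_on_unit` (class scalars first, `β` inside) with the cut-off
  `1_{smallFieldSet Λ p(η)}` replaced by `1_{(z ↦ z ∘ e)⁻¹' Ev(p(η))}` for ANY measurable family `Ev : ℝ → Set (β → ℝ)` with `cube(p∕λ) ⊆ Ev p ⊆ cube(p)`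
  (`p > 0`; `λ ≥ 1` a class scalar), every variable cut off (`I := Λ`, as in print), error `max(C₁,C₂)·η^κ·|Λ|`, SAME cumulant term.
* §4 ★★★ `eq324_torus_ballCutoff_on_unit` — the instance `Ev p := {ω | ∀ b₀, √(Σ_{π b = b₀} ω_b²) ≤ p}` with `λ := √n`: print's `Π_b χ(|A(b)| ≤ p)` in an
  orthonormal basis of `𝔤` (`n = d(𝔤)` components per bond).
HONEST SCOPE.  Count-neutral elementary bookkeeping (monotonicity of the integral and of `log`) over LANDED theorems; the cut-off SHAPE is a located
DESIGN point for the (uncommissioned) IDENT — which event NODE 00 pins as `(𝔖 k).box h` — not a defect of a landed file and not a gap in print; the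
closed ball `≤ p` is typed (print's strict `<` differs by a Lebesgue-null sphere; `λ := 2√n` serves it through §3 verbatim); the member rows stay
DISPLAYED (node N06's content); nothing of [Balaban1985UV3], [Balaban1984UV2], [BenfattoEtAl1978] or [Balaban1985BackgroundPropagators] is asserted or
discharged; `PrintedUV3V` NOT proved; node N08 NOT discharged; nothing about d = 4, the continuum, OS axioms, a mass gap or the Clay problem.
-/

noncomputable section

open MeasureTheory Finset Matrix

namespace Literature.MathematicalPhysics.QuantumFieldTheory.Balaban1983to89.B1Eq324BenfattoClassSandwichedCutoff

open Literature.MathematicalPhysics.QuantumFieldTheory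
open Literature.MathematicalPhysics.QuantumFieldTheory.Balaban1983to89.B1Eq324BenfattoLemma
open Literature.MathematicalPhysics.QuantumFieldTheory.Balaban1983to89.B1Eq324BenfattoClassTorusWindow (exists_presentation_of_torusDecay)
open Literature.MathematicalPhysics.QuantumFieldTheory.Balaban1983to89.B1Eq324BenfattoClassPresentation (measurable_restrictAlong)
open Literature.MathematicalPhysics.QuantumFieldTheory.Balaban1983to89.B1Eq324BenfattoKernelEq324AnyGammaUnitRange (eq324_kernel_of_expDecay_on_unit)
open Literature.MathematicalPhysics.QuantumFieldTheory.Balaban1983to89.B1Eq324BenfattoSect5Eq515 (measurable_hamiltonian)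

variable {d : ℕ}

/-! ## §1  The monotone sandwich (any measure, any Hamiltonian, any events) -/

section Sandwich

variable {Ω : Type*} [MeasurableSpace Ω] {μ : Measure Ω}

/-- kernel: a Bochner integral that is positive is the integral of an integrable function. [folklore] -/
private theorem integrable_of_integral_pos {f : Ω → ℝ} (h : 0 < ∫ x, f x ∂μ) : Integrable f μ := by
  by_contra hf
  rw [integral_undef hf] at h
  exact lt_irrefl _ h

/-- ★★ **THE (3.24) PAIR PASSES TO ANY SANDWICHED CUT-OFF.**  For events `E₁ ⊆ E ⊆ E₂` (`E` measurable) and a measurable `H`: if the two outer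
cut-off integrals are positive and `ε`-close to `c` in logarithm — `0 < ∫1_{E_i}e^H`, `|log ∫1_{E_i}e^H − c| ≤ ε` — then so is the middle one:
`0 < ∫1_E e^H` and `|log ∫1_E e^H − c| ≤ ε` (the integrand is nonnegative, so the three integrals are ordered; `log` is monotone).  With `c` the cumulant
sum, which does not depend on the cut-off, this transfers [Balaban1982Higgs1] (3.24) from coordinate boxes to any event between two of them.
[cite: Balaban1982Higgs1, (3.24) p.616; Balaban1985UV3, (51) p.268, (58) p.270 (the cut-off `χ`; sandwich ours)] -/
theorem eq324_pair_of_sandwich {E₁ E E₂ : Set Ω} {H : Ω → ℝ} (hH : Measurable H) (hE : MeasurableSet E)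
    (h₁ : E₁ ⊆ E) (h₂ : E ⊆ E₂) {c ε : ℝ}
    (hpos₁ : 0 < ∫ x, E₁.indicator (fun x => Real.exp (H x)) x ∂μ)
    (hpos₂ : 0 < ∫ x, E₂.indicator (fun x => Real.exp (H x)) x ∂μ)
    (hb₁ : |Real.log (∫ x, E₁.indicator (fun x => Real.exp (H x)) x ∂μ) - c| ≤ ε)
    (hb₂ : |Real.log (∫ x, E₂.indicator (fun x => Real.exp (H x)) x ∂μ) - c| ≤ ε) :
    0 < ∫ x, E.indicator (fun x => Real.exp (H x)) x ∂μ ∧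
      |Real.log (∫ x, E.indicator (fun x => Real.exp (H x)) x ∂μ) - c| ≤ ε := by
  set g : Ω → ℝ := fun x => Real.exp (H x) with hg
  have hg0 : ∀ x, 0 ≤ g x := fun x => (Real.exp_pos _).le
  have hI₁ : Integrable (E₁.indicator g) μ := integrable_of_integral_pos hpos₁
  have hI₂ : Integrable (E₂.indicator g) μ := integrable_of_integral_pos hpos₂
  have hgm : Measurable g := Real.measurable_exp.comp hH
  have hI : Integrable (E.indicator g) μ := by
    refine hI₂.mono' ((hgm.indicator hE).aestronglyMeasurable) (Filter.Eventually.of_forall fun x => ?_)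
    rw [Real.norm_eq_abs, abs_of_nonneg (Set.indicator_nonneg (fun y _ => hg0 y) x)]
    exact Set.indicator_le_indicator_of_subset h₂ hg0 x
  have hle₁ : ∫ x, E₁.indicator g x ∂μ ≤ ∫ x, E.indicator g x ∂μ :=
    integral_mono hI₁ hI fun x => Set.indicator_le_indicator_of_subset h₁ hg0 x
  have hle₂ : ∫ x, E.indicator g x ∂μ ≤ ∫ x, E₂.indicator g x ∂μ :=
    integral_mono hI hI₂ fun x => Set.indicator_le_indicator_of_subset h₂ hg0 x
  have hpos : 0 < ∫ x, E.indicator g x ∂μ := hpos₁.trans_le hle₁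
  refine ⟨hpos, ?_⟩
  have hlog₁ : Real.log (∫ x, E₁.indicator g x ∂μ) ≤ Real.log (∫ x, E.indicator g x ∂μ) := Real.log_le_log hpos₁ hle₁
  have hlog₂ : Real.log (∫ x, E.indicator g x ∂μ) ≤ Real.log (∫ x, E₂.indicator g x ∂μ) := Real.log_le_log hpos hle₂
  rw [abs_sub_le_iff] at hb₁ hb₂ ⊢
  constructor <;> linarith [hb₁.1, hb₁.2, hb₂.1, hb₂.2]

end Sandwich

/-! ## §2  Print's product of `𝔤`-norm balls versus the coordinate cube -/

section Ball

variable {β B : Type*} [Fintype β] [DecidableEq B]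

/-- **BALLS ⊆ CUBE**: if every bond's Euclidean norm is `≤ p` then every real coordinate is `≤ p` in absolute value (`|ω_b| ≤ √(Σ_{fibre} ω²)`).
[cite: Balaban1985UV3, (51) p.268 («χ({|A(b)| < g_kp²(g_k)})»); Balaban1985BackgroundPropagators, p.390 (Hilbert–Schmidt norm)] -/
theorem abs_le_of_ballProduct (π : β → B) {p : ℝ} {ω : β → ℝ}
    (h : ∀ b₀ : B, Real.sqrt (∑ b ∈ Finset.univ.filter (fun b => π b = b₀), ω b ^ 2) ≤ p) : ∀ b, |ω b| ≤ p := by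
  intro b
  have hmem : b ∈ Finset.univ.filter (fun b' => π b' = π b) := by simp
  have h1 : ω b ^ 2 ≤ ∑ b' ∈ Finset.univ.filter (fun b' => π b' = π b), ω b' ^ 2 :=
    Finset.single_le_sum (fun b' _ => sq_nonneg (ω b')) hmem
  rw [← Real.sqrt_sq_eq_abs]
  exact (Real.sqrt_le_sqrt h1).trans (h (π b))

/-- **CUBE(p∕√n) ⊆ BALLS(p)**: if every fibre of the bond map `π` has at most `n` coordinates and every coordinate is `≤ p∕√n` in absolute value then
every bond's Euclidean norm is `≤ p` (`p ≥ 0`). [cite: Balaban1985UV3, (51) p.268; Balaban1985BackgroundPropagators, p.390 (Hilbert–Schmidt norm; bookkeeping ours)] -/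
theorem ballProduct_of_abs_le (π : β → B) {n : ℕ} (hn : ∀ b₀ : B, (Finset.univ.filter (fun b => π b = b₀)).card ≤ n)
    {p : ℝ} (hp : 0 ≤ p) {ω : β → ℝ} (h : ∀ b, |ω b| ≤ p / Real.sqrt n) :
    ∀ b₀ : B, Real.sqrt (∑ b ∈ Finset.univ.filter (fun b => π b = b₀), ω b ^ 2) ≤ p := by
  intro b₀
  have hsum : ∑ b ∈ Finset.univ.filter (fun b => π b = b₀), ω b ^ 2 ≤ p ^ 2 := by
    rcases Nat.eq_zero_or_pos n with hn0 | hnpos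
    · have hem : Finset.univ.filter (fun b => π b = b₀) = ∅ :=
        Finset.card_eq_zero.mp (Nat.le_zero.mp (hn0 ▸ hn b₀))
      rw [hem, Finset.sum_empty]
      positivity
    · have hsq : ∀ b, ω b ^ 2 ≤ (p / Real.sqrt n) ^ 2 := fun b => by
        rw [← sq_abs]
        exact pow_le_pow_left₀ (abs_nonneg _) (h b) 2
      have hn' : (0 : ℝ) < n := by exact_mod_cast hnpos
      calc ∑ b ∈ Finset.univ.filter (fun b => π b = b₀), ω b ^ 2
          ≤ ∑ _b ∈ Finset.univ.filter (fun b => π b = b₀), (p / Real.sqrt n) ^ 2 := Finset.sum_le_sum fun b _ => hsq b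
        _ = (Finset.univ.filter (fun b => π b = b₀)).card * (p / Real.sqrt n) ^ 2 := by rw [Finset.sum_const, nsmul_eq_mul]
        _ ≤ n * (p / Real.sqrt n) ^ 2 := mul_le_mul_of_nonneg_right (by exact_mod_cast hn b₀) (sq_nonneg _)
        _ = p ^ 2 := by
            rw [div_pow, Real.sq_sqrt hn'.le]
            field_simp
  calc Real.sqrt (∑ b ∈ Finset.univ.filter (fun b => π b = b₀), ω b ^ 2) ≤ Real.sqrt (p ^ 2) := Real.sqrt_le_sqrt hsum
    _ = p := Real.sqrt_sq hp

/-- The ball-product event `{ω | ∀ b₀, √(Σ_{π b = b₀} ω_b²) ≤ p}` is measurable (finitely many bonds).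
[cite: Balaban1985UV3, (51) p.268 (the cut-off `χ`; measurability bookkeeping ours)] -/
theorem measurableSet_ballProduct [Fintype B] (π : β → B) (p : ℝ) :
    MeasurableSet {ω : β → ℝ | ∀ b₀ : B, Real.sqrt (∑ b ∈ Finset.univ.filter (fun b => π b = b₀), ω b ^ 2) ≤ p} := by
  have h : {ω : β → ℝ | ∀ b₀ : B, Real.sqrt (∑ b ∈ Finset.univ.filter (fun b => π b = b₀), ω b ^ 2) ≤ p} =
      ⋂ b₀ : B, {ω : β → ℝ | Real.sqrt (∑ b ∈ Finset.univ.filter (fun b => π b = b₀), ω b ^ 2) ≤ p} := by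
    ext ω
    simp only [Set.mem_setOf_eq, Set.mem_iInter]
  rw [h]
  refine MeasurableSet.iInter fun b₀ => measurableSet_le ?_ measurable_const
  refine (Finset.measurable_sum _ fun b _ => ?_).sqrt
  exact (measurable_pi_apply b).pow_const 2

end Ball

/-! ## §3  (3.24) on a torus block for every sandwiched cut-off, every `η ∈ (0,1]` -/

section Torus

/-- kernel: `p_{b₀}(η) > 0` for `b₀ > 0` and `0 < η ≤ 1`. [cite: Balaban1985UV3, (7) p.257] -/
private theorem pFun_pos {b₀ p₀ η : ℝ} (hb₀ : 0 < b₀) (hη : 0 < η) (hη1 : η ≤ 1) : 0 < B10.pFun b₀ p₀ η := by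
  simp only [B10.pFun]
  have h1 : 1 ≤ 1 + Real.log η⁻¹ := by
    have : 0 ≤ Real.log η⁻¹ := Real.log_nonneg ((one_le_inv₀ hη).mpr hη1)
    linarith
  exact mul_pos hb₀ (Real.rpow_pos_of_pos (by linarith) _)

/-- ★★★ **[Balaban1982Higgs1] (3.24) ON A TORUS BLOCK FOR EVERY CUT-OFF SANDWICHED BETWEEN TWO COORDINATE BOXES, AT EVERY COUPLING `η ∈ (0,1]`.**
Class scalars FIRST: `d ≥ 1`, label count `m`, member scalars `γ > 0`, `K ≥ 0`, `κ_T > 0`, the sandwich ratio `λ ≥ 1`, and the (3.24) letters `t D`,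
`ϰ > 0`, `p₀ > 2/3`, `σ > 0`, `c ≥ 0`, `0 < κ < σ(t+1)`.  THEN `∃ b₁ ∀ b₀ > b₁ ∃ C ≥ 0` such that for EVERY `η ∈ (0,1]`, torus size `N`, variables
`β ≠ ∅` labelled injectively by `(site, lab)`, EVERY precision `T` (symmetric, `γ`-coercive, `|T b b′| ≤ K e^{−κ_Tρ}` with `ρ` dominating the torus
sup-distance): a window `Λ ⊂ ℤ^{2d+1}`, `e : β ≃ ↥Λ` with the presentation of `𝒩(0, T⁻¹)` and the a.e. box identity (as in
`…ClassSectEMember.eq324_torus_of_expDecay_on_unit`), AND for EVERY measurable family of events `Ev : ℝ → Set (β → ℝ)` with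
`{∀ b, |ω_b| ≤ p∕λ} ⊆ Ev p ⊆ {∀ b, |ω_b| ≤ p}` (`p > 0`) and all `(s, J ⊆ Λ, a)` with `sup|a| ≤ c·η^σ`:
`0 < ∫ 1_{(z ↦ z∘e)⁻¹' Ev(p_{b₀}(η))} e^{H_J} dμ_K` and `|log ∫ 1_{(z ↦ z∘e)⁻¹' Ev(p_{b₀}(η))} e^{H_J} dμ_K − Σ_{k≤t}𝓔^T(H_J;k)/k!| ≤ C·η^κ·|Λ|` — the road at the two
threshold constants `b₀` and `b₀∕λ` on the SAME presentation (`I := Λ`: every variable cut off — a specialisation of the road's `∀ I ⊇ J` shape, as print's `Π_b`), seat n08-b's `…ClassRescale.pFun_div`, the one-stop's a.e. box identity `(z ↦ z∘e)⁻¹'{|ω_b| ≤ q} =ᵐ smallFieldSet Λ q` (`…ClassTorusWindow.exists_presentation_of_torusDecay`), and §1.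
[cite: Balaban1982Higgs1, (3.24) p.616; Balaban1985UV3, (51) p.268, (58) p.270; BenfattoEtAl1978, Lemma (4.5)–(4.7) p.152 (class form);
Balaban1985BackgroundPropagators, Sect. E p.428 (class form; the bent window and the sandwich are ours)] -/
theorem eq324_torus_sandwichedCutoff_on_unit (hd : 0 < d) (m : ℕ) {γ K κT lam : ℝ} (hγ0 : 0 < γ) (hK : 0 ≤ K) (hκT : 0 < κT)
    (hlam : 1 ≤ lam) (t D : ℕ) {ϰ : ℝ} (hϰ : 0 < ϰ) {p₀ σ c κ : ℝ} (hp₀ : 2 / 3 < p₀) (hσ : 0 < σ) (hc : 0 ≤ c) (hκ : 0 < κ)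
    (hκσ : κ < σ * (t + 1)) :
    ∃ b₁ : ℝ, ∀ b₀ : ℝ, b₁ < b₀ → ∃ C : ℝ, 0 ≤ C ∧ ∀ η : ℝ, 0 < η → η ≤ 1 →
      ∀ {N : ℕ} [NeZero N] {β : Type} [Fintype β] [DecidableEq β] [Nonempty β]
        (site : β → Fin d → ZMod N) (lab : β → Fin m), (Function.Injective fun b => (site b, lab b)) →
      ∀ {T : Matrix β β ℝ} {ρ : β → β → ℝ}, (∀ b b', T b b' = T b' b) →
        (∀ v : β → ℝ, γ * ∑ b, v b ^ 2 ≤ ∑ b, ∑ b', T b b' * v b * v b') →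
        (∀ b b', |T b b'| ≤ K * Real.exp (-(κT * ρ b b'))) →
        (∀ b b' i, (|((site b i - site b' i).valMinAbs : ℤ)| : ℝ) ≤ ρ b b') →
      ∃ (Λ : Finset (B1Eq324BenfattoLemma.Site (d + d + 1))) (e : β ≃ ↥Λ),
        ((gaussianFieldOfKernel fun x y => if h : x ∈ Λ ∧ y ∈ Λ then ((Matrix.reindex e e T)⁻¹ : Matrix ↥Λ ↥Λ ℝ) ⟨x, h.1⟩ ⟨y, h.2⟩ else 0).map
            (fun (z : B1Eq324BenfattoLemma.Site (d + d + 1) → ℝ) (b : β) => z ((e b : ↥Λ) : B1Eq324BenfattoLemma.Site (d + d + 1))) =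
          gaussianFieldOfKernel fun b b' => (T⁻¹ : Matrix β β ℝ) b b') ∧
        (∀ p : ℝ, 0 ≤ p →
          ((fun (z : B1Eq324BenfattoLemma.Site (d + d + 1) → ℝ) (b : β) => z ((e b : ↥Λ) : B1Eq324BenfattoLemma.Site (d + d + 1))) ⁻¹'
              {ω : β → ℝ | ∀ b, |ω b| ≤ p}) =ᵐ[gaussianFieldOfKernel fun x y =>
                if h : x ∈ Λ ∧ y ∈ Λ then ((Matrix.reindex e e T)⁻¹ : Matrix ↥Λ ↥Λ ℝ) ⟨x, h.1⟩ ⟨y, h.2⟩ else 0] smallFieldSet Λ p) ∧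
        ∀ (Ev : ℝ → Set (β → ℝ)), (∀ p, MeasurableSet (Ev p)) →
          (∀ p : ℝ, 0 < p → ∀ ω : β → ℝ, (∀ b, |ω b| ≤ p / lam) → ω ∈ Ev p) →
          (∀ p : ℝ, ∀ ω ∈ Ev p, ∀ b, |ω b| ≤ p) →
        ∀ (s : ℕ) (J : Finset (B1Eq324BenfattoLemma.Site (d + d + 1))) (a : Coef (d + d + 1)), J ⊆ Λ →
          coefSup s D a J ≤ c * η ^ σ →
          0 < ∫ z, ((fun (z : B1Eq324BenfattoLemma.Site (d + d + 1) → ℝ) (b : β) => z ((e b : ↥Λ) : B1Eq324BenfattoLemma.Site (d + d + 1))) ⁻¹'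
                Ev (B10.pFun b₀ p₀ η)).indicator (fun z => Real.exp (hamiltonian s D ϰ a J z)) z ∂(gaussianFieldOfKernel fun x y =>
              if h : x ∈ Λ ∧ y ∈ Λ then ((Matrix.reindex e e T)⁻¹ : Matrix ↥Λ ↥Λ ℝ) ⟨x, h.1⟩ ⟨y, h.2⟩ else 0) ∧
            |Real.log (∫ z, ((fun (z : B1Eq324BenfattoLemma.Site (d + d + 1) → ℝ) (b : β) => z ((e b : ↥Λ) : B1Eq324BenfattoLemma.Site (d + d + 1))) ⁻¹'
                Ev (B10.pFun b₀ p₀ η)).indicator (fun z => Real.exp (hamiltonian s D ϰ a J z)) z ∂(gaussianFieldOfKernel fun x y =>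
                if h : x ∈ Λ ∧ y ∈ Λ then ((Matrix.reindex e e T)⁻¹ : Matrix ↥Λ ↥Λ ℝ) ⟨x, h.1⟩ ⟨y, h.2⟩ else 0)) -
              cumulantSum (gaussianFieldOfKernel fun x y =>
                if h : x ∈ Λ ∧ y ∈ Λ then ((Matrix.reindex e e T)⁻¹ : Matrix ↥Λ ↥Λ ℝ) ⟨x, h.1⟩ ⟨y, h.2⟩ else 0)
                (hamiltonian s D ϰ a J) t| ≤ C * η ^ κ * Λ.card := by
  have hd' : 0 < d + d + 1 := by omega
  have hKA : 0 ≤ K * Real.exp (κT * m) := by positivity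
  have hκA : 0 < κT / Real.sqrt (d + d + 1) := div_pos hκT (Real.sqrt_pos.mpr (by positivity))
  have hlam0 : 0 < lam := by linarith
  obtain ⟨b₁, hb₁⟩ := eq324_kernel_of_expDecay_on_unit (d := d + d + 1) hd' hγ0 hKA hκA t D hϰ hp₀ hσ hc hκ hκσ
  refine ⟨max 0 (max b₁ (lam * b₁)), fun b₀ hb₀ => ?_⟩
  have hb₀0 : 0 < b₀ := lt_of_le_of_lt (le_max_left _ _) hb₀
  have hb₀1 : b₁ < b₀ := lt_of_le_of_lt ((le_max_left _ _).trans (le_max_right _ _)) hb₀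
  have hb₀2 : b₁ < b₀ / lam := by
    rw [lt_div_iff₀ hlam0, mul_comm]
    exact lt_of_le_of_lt ((le_max_right _ _).trans (le_max_right _ _)) hb₀
  obtain ⟨C₁, hC₁, hE₁⟩ := hb₁ b₀ hb₀1
  obtain ⟨C₂, hC₂, hE₂⟩ := hb₁ (b₀ / lam) hb₀2
  refine ⟨max C₁ C₂, le_max_of_le_left hC₁, fun η hη hηle N _ β _ _ _ site lab hinj T ρ hTs hγ hdec hρ => ?_⟩
  obtain ⟨Λ, e, hsymm, hcoer, hdec', hmap, hbox⟩ :=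
    exists_presentation_of_torusDecay d N m hd site lab hinj hTs hγ0 hγ hK hκT.le hdec hρ
  refine ⟨Λ, e, hmap, hbox, fun Ev hEvm hEvlo hEvhi s J a hJΛ hA => ?_⟩
  have hΛ : Λ.Nonempty := ⟨_, (e (Classical.arbitrary β)).2⟩
  -- the road at the two thresholds, on the SAME presentation, with every variable cut off (`I := Λ`)
  have h1 := hE₁ η hη hηle (fun x y => rfl) hΛ hsymm hcoer hdec' s Λ J a hΛ hJΛ hJΛ hA
  have h2 := hE₂ η hη hηle (fun x y => rfl) hΛ hsymm hcoer hdec' s Λ J a hΛ hJΛ hJΛ hA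
  -- letters
  set μK := gaussianFieldOfKernel fun x y => if h : x ∈ Λ ∧ y ∈ Λ then ((Matrix.reindex e e T)⁻¹ : Matrix ↥Λ ↥Λ ℝ) ⟨x, h.1⟩ ⟨y, h.2⟩ else 0
    with hμK
  set rA : (B1Eq324BenfattoLemma.Site (d + d + 1) → ℝ) → β → ℝ :=
    fun z b => z ((e b : ↥Λ) : B1Eq324BenfattoLemma.Site (d + d + 1)) with hrA
  set p : ℝ := B10.pFun b₀ p₀ η with hp
  have hp0 : 0 < p := pFun_pos hb₀0 hη hηle
  have hpdiv : B10.pFun (b₀ / lam) p₀ η = p / lam := B1Eq324BenfattoClassRescale.pFun_div b₀ p₀ η lam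
  have hplam0 : 0 ≤ p / lam := div_nonneg hp0.le hlam0.le
  rw [hpdiv] at h2
  simp only [cutoffBoltzmann] at h1 h2
  -- the two outer cut-off integrals, rewritten on the pulled-back coordinate cubes
  have hrAm : Measurable rA := measurable_restrictAlong e
  set G : (B1Eq324BenfattoLemma.Site (d + d + 1) → ℝ) → ℝ := fun z => Real.exp (hamiltonian s D ϰ a J z) with hG
  have hc₂ : ∫ z, (smallFieldSet Λ p).indicator G z ∂μK = ∫ z, (rA ⁻¹' {ω : β → ℝ | ∀ b, |ω b| ≤ p}).indicator G z ∂μK :=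
    integral_congr_ae (indicator_ae_eq_of_ae_eq_set (hbox p hp0.le).symm)
  have hc₁ : ∫ z, (smallFieldSet Λ (p / lam)).indicator G z ∂μK = ∫ z, (rA ⁻¹' {ω : β → ℝ | ∀ b, |ω b| ≤ p / lam}).indicator G z ∂μK :=
    integral_congr_ae (indicator_ae_eq_of_ae_eq_set (hbox (p / lam) hplam0).symm)
  rw [hc₂] at h1
  rw [hc₁] at h2
  -- the sandwich
  have hsub₁ : rA ⁻¹' {ω : β → ℝ | ∀ b, |ω b| ≤ p / lam} ⊆ rA ⁻¹' Ev p :=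
    fun z hz => hEvlo p hp0 (rA z) hz
  have hsub₂ : rA ⁻¹' Ev p ⊆ rA ⁻¹' {ω : β → ℝ | ∀ b, |ω b| ≤ p} :=
    fun z hz => hEvhi p (rA z) hz
  have hεmono₁ : C₁ * η ^ κ * (Λ.card : ℝ) ≤ max C₁ C₂ * η ^ κ * (Λ.card : ℝ) := by
    have : 0 ≤ η ^ κ * (Λ.card : ℝ) := by positivity
    nlinarith [le_max_left C₁ C₂]
  have hεmono₂ : C₂ * η ^ κ * (Λ.card : ℝ) ≤ max C₁ C₂ * η ^ κ * (Λ.card : ℝ) := by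
    have : 0 ≤ η ^ κ * (Λ.card : ℝ) := by positivity
    nlinarith [le_max_right C₁ C₂]
  exact eq324_pair_of_sandwich (μ := μK) (measurable_hamiltonian J) (hrAm (hEvm p)) hsub₁ hsub₂
    h2.1 h1.1 (h2.2.trans hεmono₂) (h1.2.trans hεmono₁)

/-- ★★★ **(3.24) ON A TORUS BLOCK WITH PRINT'S PRODUCT OF `𝔤`-NORM BALLS AS THE CUT-OFF, AT EVERY COUPLING `η ∈ (0,1]`** — §3 at the event
`Ev p := {ω | ∀ b₀, √(Σ_{π b = b₀} ω_b²) ≤ p}` for a bond map `π : β → B` whose fibres (the `𝔤`-components of one bond) have at most `n` coordinates,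
`λ := √n` (`n ≥ 1` a class scalar): `χ = Π_b χ(|A(b)| ≤ p_{b₀}(g_k))` in an orthonormal basis of `𝔤` (Hilbert–Schmidt norm).  Window `b₀ > max(0, b₁, √n·b₁)`.
[cite: Balaban1985UV3, (51) p.268, (58) p.270; Balaban1985BackgroundPropagators, p.390; Balaban1982Higgs1, (3.24) p.616; BenfattoEtAl1978, Lemma (4.5)–(4.7) p.152
(class form; the sandwich is ours)] -/
theorem eq324_torus_ballCutoff_on_unit (hd : 0 < d) (m n : ℕ) (hn : 1 ≤ n) {γ K κT : ℝ} (hγ0 : 0 < γ) (hK : 0 ≤ K) (hκT : 0 < κT)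
    (t D : ℕ) {ϰ : ℝ} (hϰ : 0 < ϰ) {p₀ σ c κ : ℝ} (hp₀ : 2 / 3 < p₀) (hσ : 0 < σ) (hc : 0 ≤ c) (hκ : 0 < κ)
    (hκσ : κ < σ * (t + 1)) :
    ∃ b₁ : ℝ, ∀ b₀ : ℝ, b₁ < b₀ → ∃ C : ℝ, 0 ≤ C ∧ ∀ η : ℝ, 0 < η → η ≤ 1 →
      ∀ {N : ℕ} [NeZero N] {β : Type} [Fintype β] [DecidableEq β] [Nonempty β]
        (site : β → Fin d → ZMod N) (lab : β → Fin m), (Function.Injective fun b => (site b, lab b)) →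
      ∀ {T : Matrix β β ℝ} {ρ : β → β → ℝ}, (∀ b b', T b b' = T b' b) →
        (∀ v : β → ℝ, γ * ∑ b, v b ^ 2 ≤ ∑ b, ∑ b', T b b' * v b * v b') →
        (∀ b b', |T b b'| ≤ K * Real.exp (-(κT * ρ b b'))) →
        (∀ b b' i, (|((site b i - site b' i).valMinAbs : ℤ)| : ℝ) ≤ ρ b b') →
      ∃ (Λ : Finset (B1Eq324BenfattoLemma.Site (d + d + 1))) (e : β ≃ ↥Λ),
        ((gaussianFieldOfKernel fun x y => if h : x ∈ Λ ∧ y ∈ Λ then ((Matrix.reindex e e T)⁻¹ : Matrix ↥Λ ↥Λ ℝ) ⟨x, h.1⟩ ⟨y, h.2⟩ else 0).map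
            (fun (z : B1Eq324BenfattoLemma.Site (d + d + 1) → ℝ) (b : β) => z ((e b : ↥Λ) : B1Eq324BenfattoLemma.Site (d + d + 1))) =
          gaussianFieldOfKernel fun b b' => (T⁻¹ : Matrix β β ℝ) b b') ∧
        ∀ {B : Type} [Fintype B] [DecidableEq B] (π : β → B),
          (∀ c₀ : B, (Finset.univ.filter (fun b => π b = c₀)).card ≤ n) →
        ∀ (s : ℕ) (J : Finset (B1Eq324BenfattoLemma.Site (d + d + 1))) (a : Coef (d + d + 1)), J ⊆ Λ →
          coefSup s D a J ≤ c * η ^ σ →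
          0 < ∫ z, ((fun (z : B1Eq324BenfattoLemma.Site (d + d + 1) → ℝ) (b : β) => z ((e b : ↥Λ) : B1Eq324BenfattoLemma.Site (d + d + 1))) ⁻¹'
                {ω : β → ℝ | ∀ c₀ : B, Real.sqrt (∑ b ∈ Finset.univ.filter (fun b => π b = c₀), ω b ^ 2) ≤ B10.pFun b₀ p₀ η}).indicator
                (fun z => Real.exp (hamiltonian s D ϰ a J z)) z ∂(gaussianFieldOfKernel fun x y =>
              if h : x ∈ Λ ∧ y ∈ Λ then ((Matrix.reindex e e T)⁻¹ : Matrix ↥Λ ↥Λ ℝ) ⟨x, h.1⟩ ⟨y, h.2⟩ else 0) ∧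
            |Real.log (∫ z, ((fun (z : B1Eq324BenfattoLemma.Site (d + d + 1) → ℝ) (b : β) => z ((e b : ↥Λ) : B1Eq324BenfattoLemma.Site (d + d + 1))) ⁻¹'
                {ω : β → ℝ | ∀ c₀ : B, Real.sqrt (∑ b ∈ Finset.univ.filter (fun b => π b = c₀), ω b ^ 2) ≤ B10.pFun b₀ p₀ η}).indicator
                (fun z => Real.exp (hamiltonian s D ϰ a J z)) z ∂(gaussianFieldOfKernel fun x y =>
                if h : x ∈ Λ ∧ y ∈ Λ then ((Matrix.reindex e e T)⁻¹ : Matrix ↥Λ ↥Λ ℝ) ⟨x, h.1⟩ ⟨y, h.2⟩ else 0)) -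
              cumulantSum (gaussianFieldOfKernel fun x y =>
                if h : x ∈ Λ ∧ y ∈ Λ then ((Matrix.reindex e e T)⁻¹ : Matrix ↥Λ ↥Λ ℝ) ⟨x, h.1⟩ ⟨y, h.2⟩ else 0)
                (hamiltonian s D ϰ a J) t| ≤ C * η ^ κ * Λ.card := by
  have hlam : (1 : ℝ) ≤ Real.sqrt n := by
    rw [show (1 : ℝ) = Real.sqrt 1 from Real.sqrt_one.symm]
    exact Real.sqrt_le_sqrt (by exact_mod_cast hn)
  obtain ⟨b₁, hb₁⟩ := eq324_torus_sandwichedCutoff_on_unit (d := d) hd m hγ0 hK hκT hlam t D hϰ hp₀ hσ hc hκ hκσ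
  refine ⟨b₁, fun b₀ hb₀ => ?_⟩
  obtain ⟨C, hC, hE⟩ := hb₁ b₀ hb₀
  refine ⟨C, hC, fun η hη hηle N _ β _ _ _ site lab hinj T ρ hTs hγ hdec hρ => ?_⟩
  obtain ⟨Λ, e, hmap, -, hEv⟩ := hE η hη hηle site lab hinj hTs hγ hdec hρ
  refine ⟨Λ, e, hmap, @fun B _ _ π hπ s J a hJΛ hA => ?_⟩
  exact hEv (fun p => {ω : β → ℝ | ∀ b₀ : B, Real.sqrt (∑ b ∈ Finset.univ.filter (fun b => π b = b₀), ω b ^ 2) ≤ p})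
    (fun p => measurableSet_ballProduct π p)
    (fun p hp ω hω => ballProduct_of_abs_le π hπ hp.le hω)
    (fun p ω hω => abs_le_of_ballProduct π hω) s J a hJΛ hA

/-- Non-vacuity of the scalar side of `eq324_torus_ballCutoff_on_unit`: `d = 3`, `m = 24` labels, `n = 8 = d(su(3))` colours per bond, member scalars
`γ = 1`, `K = 2`, `κ_T = 1/3`, socket letters `t = 6`, `D = 4`, `ϰ = 1`, `p₀ = 1`, `σ = 1/2`, `c = 1`, `κ = 13/4`.
[cite: Balaban1985UV3, (58) p.270 (letters of the socket; instance ours)] -/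
example :=
  eq324_torus_ballCutoff_on_unit (d := 3) (by norm_num) 24 8 (by norm_num) (γ := 1) (K := 2) (κT := 1 / 3) one_pos (by norm_num)
    (by norm_num) 6 4 (ϰ := 1) one_pos (p₀ := 1) (σ := 1 / 2) (c := 1) (κ := 13 / 4) (by norm_num) (by norm_num) zero_le_one
    (by norm_num) (by norm_num)

end Torus

end Literature.MathematicalPhysics.QuantumFieldTheory.Balaban1983to89.B1Eq324BenfattoClassSandwichedCutoff

end
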